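import Summits.BirchSwinnertonDyer.BirchSwinnertonDyer.Theorems.TeichmullerTwistDescentDefs
import Summits.BirchSwinnertonDyer.BirchSwinnertonDyer.Theorems.TeichmullerTwistDescentTypeLatticeNoCaseOne
import Summits.BirchSwinnertonDyer.BirchSwinnertonDyer.Theorems.TeichmullerTwistDescentTwistOperatorPeriodHomology
import HarnessLib

/-!
# Route `TeichmullerTwistDescent`, crux K `TwistedPeriodLatticeSaturation` (stmt-BirchSwinnertonDyer-25368):
# «case one» excluded by a datum on the PERIOD HOMOLOGY `H₁(X₀(N), ℤ)` (maps on `periodHomology N`, not on `Λ(f)`)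

Cell `pub/bsd-wall` (D-0145 line route-BirchSwinnertonDyer-TeichmullerTwistDescent, OPEN rev 7), seat `bsd-line-ttd-p1`
(prover 1/2, g22).  THEOREMS ONLY (no definition, no named fact, no `sorry`).  BSD is not proved by this file; K is NOT
proved.  Sequel of `TeichmullerTwistDescentTypeLatticeNoCaseOne`: there the transfer datum (I2) was phrased as additive
maps on the period lattices `Λ(f)`, `Λ(f ⊗ χ) ⊆ ℂ`; the carrier that (I2) naturally produces is a map on the integral
homology `H = periodHomology N ⊆ S₂(Γ₀(N))^∨` (tree `ModularSymbolsPeriodHomology`: `Λ(f) = ev_f(H)`,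
`periodLattice_eq_map_periodHomology`) — «`H ⊗ ℤ_p ↠ Q_W ⊗ ℤ_p = Λ_Q^{T̃}`» (audit (S2)).  This file states the
exclusion of case one with the datum ON `H`: `βH, βHχ : H →+ ℤ_p^{ℙ¹(𝔽_p)}` with `βH` vanishing on `{φ : φ(f) = 0}`, landing
in the `T`-invariants of the type lattice `Λ'`, `βHχ(H)` spanning over its `χ∘det`-line, and the INTERTWINING with the
twisting operator of `H` (tree `TwistOperatorPeriodHomology.exists_twist_mem_periodHomology`: `ψ = T_χ φ` iff
`ψ(h) = g(χ)·φ(h ⊗ χ)` for all `h`): `βH(T_χ φ) = T_χ^{coord}(βHχ φ)`.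

* **`not_caseOne_of_homologyLevelDatum`** — case one `g(χ)Λ(f⊗χ) ⊆ pΛ(f)` is false given such a datum (`p` odd,
  `0 < b`, `2b < p − 1`; `Λ'` with `ReductionSocleLe … (2b) Λ'`);
* `saturation_at_of_homologyLevelDatum` — the conclusion of K at `(W, p, D, χ)` (binders verbatim, `p ≥ 11`) from
  Modularity and such a datum for `N = N(W)`, `f = f_D`.
-/

set_option autoImplicit false
-- single-conjunct summit: `Summit.BirchSwinnertonDyer.BirchSwinnertonDyer.…` repeats the name by design
set_option linter.dupNamespace false

noncomputable section

open scoped Pointwise MatrixGroups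

open Function CongruenceSubgroup
open Literature.RepresentationTheory.FiniteGroups Literature.RepresentationTheory.FiniteGroups.GL2
  Literature.NumberTheory.GaussSums Literature.NumberTheory.EllipticCurves.ModularForms
open Literature.NumberTheory.EllipticCurves (Kato2004.teichmullerChar)

namespace Summit.BirchSwinnertonDyer.BirchSwinnertonDyer.Theorems.TeichmullerTwistDescent.TypeLatticeHomologyLevel

section NoCaseOne

variable (p : ℕ) [hp : Fact p.Prime] {k : Type} [Field k] [CharP k p] [Algebra ℤ_[p] k] [Finite k]

/-- **Case one is excluded by a homology-level datum.**  `p` odd, `0 < b`, `2b < p − 1`; `Λ'` a stable lattice of finite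
index in `coordRep (ω̃^{p−1−b}) (ω̃ᵇ)` with `ReductionSocleLe … (2b) Λ'`; `N` with `p² ∣ N`, `f ∈ S₂(Γ₀(N))`, `χ` primitive
quadratic mod `p`; additive `βH, βHχ : periodHomology N → ℤ_p^{ℙ¹}` with: `βH φ = 0` whenever `φ(f) = 0`; `βH(H) ⊆ Λ'^T`;
`Λ'^{T,χ∘det} ⊆ span(βHχ(H))`; and `βH ψ = T_χ(βHχ φ)` whenever `ψ(h) = g(χ)φ(h⊗χ)` for all `h` (i.e. `ψ = T_χφ` on `H`).
Then `∀ w ∈ Λ(f⊗χ), ∃ z ∈ Λ(f), g(χ)w = pz` is false: for `φ ∈ H`, `w = φ(f⊗χ)`, case one gives `φ' ∈ H` with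
`(T_χφ)(f) = g(χ)w = pφ'(f)`, so `βH(T_χφ − pφ') = 0` and `T_χ(βHχ φ) = p·βH φ' ∈ pΛ'^T`; the divisibility criterion then makes
the unit `J(ω̃^{b+(p−1)/2}, ω̃^{(p−1)/2})` divisible by `p`.
[cite: EmertonGeeSavitt2015, Lemma 4.1.1] [cite: Stevens1989, Lemma (5.4) p. 97] [cite: Lang1990, Ch. 1 §2 Thm. 2.1] -/
theorem not_caseOne_of_homologyLevelDatum (hp2 : p ≠ 2) {b : ℕ} (hb : 0 < b) (hb2 : 2 * b < p - 1)
    (hsurj : Surjective (algebraMap ℤ_[p] k))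
    (halg : ∀ x : ℤ_[p], algebraMap ℤ_[p] k x = ZMod.castHom (dvd_refl p) k (PadicInt.toZMod x))
    (Λ' : Subrepresentation
      (coordRep (Kato2004.teichmullerChar p ^ (p - 1 - b)) (Kato2004.teichmullerChar p ^ b))) {m : ℕ}
    (hm : ∀ v : Option (ZMod p) → ℤ_[p], (p : ℤ_[p]) ^ m • v ∈ Λ')
    (hsoc : ReductionSocleLe p k (Kato2004.teichmullerChar p ^ (p - 1 - b)) (Kato2004.teichmullerChar p ^ b) (2 * b) Λ')
    {N : ℕ} [NeZero N] (hpN : p ^ 2 ∣ N) (f : CuspForm (Gamma0 N) 2) {χ : DirichletCharacter ℂ p}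
    (hχ : χ.IsQuadratic) (hprim : χ.IsPrimitive)
    (βH βHχ : periodHomology N →+ (Option (ZMod p) → ℤ_[p]))
    (hker : ∀ φ : periodHomology N, (φ : Module.Dual ℂ (CuspForm (Gamma0 N) 2)) f = 0 → βH φ = 0)
    (hβW : ∀ φ : periodHomology N, βH φ ∈ Λ'.toSubmodule ⊓
      coordTorusEigenspace (Kato2004.teichmullerChar p ^ (p - 1 - b)) (Kato2004.teichmullerChar p ^ b)
        (fun _ _ => (1 : ℤ_[p])))
    (hβV : Λ'.toSubmodule ⊓
        coordTorusEigenspace (Kato2004.teichmullerChar p ^ (p - 1 - b)) (Kato2004.teichmullerChar p ^ b)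
          (fun a c : (ZMod p)ˣ => MulChar.ofUnitHom (Kato2004.teichmullerChar p ^ ((p - 1) / 2)) (a : ZMod p) *
            MulChar.ofUnitHom (Kato2004.teichmullerChar p ^ ((p - 1) / 2)) (c : ZMod p)) ≤
      Submodule.span ℤ_[p] (Set.range βHχ))
    (hβ : ∀ φ ψ : periodHomology N,
      (∀ h : CuspForm (Gamma0 N) 2, (ψ : Module.Dual ℂ (CuspForm (Gamma0 N) 2)) h =
        gaussSum χ (ZMod.stdAddChar (N := p)) *
          (φ : Module.Dual ℂ (CuspForm (Gamma0 N) 2)) (charTwist N dvd_rfl hpN hχ h)) →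
      βH ψ = coordTwistOp (Kato2004.teichmullerChar p ^ (p - 1 - b)) (Kato2004.teichmullerChar p ^ b)
        (MulChar.ofUnitHom (Kato2004.teichmullerChar p ^ ((p - 1) / 2))) (βHχ φ))
    (hcase : ∀ w ∈ periodLattice (charTwist N dvd_rfl hpN hχ f), ∃ z ∈ periodLattice f,
      gaussSum χ (ZMod.stdAddChar (N := p)) * w = (p : ℂ) * z) : False := by
  have hne := TypeLatticeNoCaseOne.quadratic_ne_of_exponents p hp2 hb hb2
  have hdvd : (p : ℤ_[p]) ∣ jacobiSum (MulChar.ofUnitHom (Kato2004.teichmullerChar p ^ b) *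
      MulChar.ofUnitHom (Kato2004.teichmullerChar p ^ ((p - 1) / 2)))
      (MulChar.ofUnitHom (Kato2004.teichmullerChar p ^ ((p - 1) / 2))) := by
    refine TypeLatticeNoCaseOne.dvd_jacobiSum_of_typeLattice p (Kato2004.teichmullerChar p ^ (p - 1 - b))
      (Kato2004.teichmullerChar p ^ b) hsurj (TypeLatticeNoCaseOne.reduceChar_ne_of_exponents p halg hb hb2)
      (TypeLatticeNoCaseOne.reduceChar_rel_of_exponents p halg (by omega)) (s := p - 1 - 2 * b) (by omega)
      (TypeLatticeNoCaseOne.teichmullerChar_pow_mul_pow_eq_one p (by omega))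
      (TypeLatticeNoCaseOne.teichmullerChar_pow_sub_ne_one p hb (by omega))
      (ofUnitHom_teichmullerChar_pow_half_inv p hp2) hne.1 hne.2 Λ' hm hsoc (Set.range βHχ) hβV ?_
    rintro _ ⟨φ, rfl⟩
    -- the twisted functional `ψ = T_χ φ ∈ H`
    obtain ⟨ψ, hψH, hψ⟩ := TwistOperatorPeriodHomology.exists_twist_mem_periodHomology hpN hχ hprim φ.2
    -- `w = φ(f ⊗ χ) ∈ Λ(f ⊗ χ)` and case one
    have hw : (φ : Module.Dual ℂ (CuspForm (Gamma0 N) 2)) (charTwist N dvd_rfl hpN hχ f) ∈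
        periodLattice (charTwist N dvd_rfl hpN hχ f) := by
      rw [periodLattice_eq_map_periodHomology]
      exact ⟨φ, φ.2, rfl⟩
    obtain ⟨z, hz, hgw⟩ := hcase _ hw
    rw [periodLattice_eq_map_periodHomology] at hz
    obtain ⟨φ', hφ'H, hφ'z⟩ := hz
    -- `(ψ - p φ')(f) = 0`
    have hval : ((⟨ψ, hψH⟩ - p • ⟨φ', hφ'H⟩ : periodHomology N) : Module.Dual ℂ (CuspForm (Gamma0 N) 2)) f = 0 := by
      rw [AddSubgroupClass.coe_sub, AddSubgroupClass.coe_nsmul, LinearMap.sub_apply, ← Nat.cast_smul_eq_nsmul ℂ,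
        LinearMap.smul_apply, smul_eq_mul, hψ f, hgw, sub_eq_zero]
      exact congrArg _ hφ'z.symm
    have h0 := hker _ hval
    rw [map_sub, map_nsmul, sub_eq_zero] at h0
    rw [← hβ φ ⟨ψ, hψH⟩ hψ, h0, ← Nat.cast_smul_eq_nsmul ℤ_[p]]
    exact Submodule.smul_mem_pointwise_smul _ _ _ (hβW ⟨φ', hφ'H⟩)
  exact (PadicInt.irreducible_p (p := p)).not_isUnit
    (isUnit_of_dvd_unit hdvd (isUnit_jacobiSum_teichmuller_quadratic_of_two_mul_lt p hp2 hb hb2))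

end NoCaseOne

section K

open WeierstrassCurve Literature.NumberTheory.EllipticCurves
  Summit.BirchSwinnertonDyer.BirchSwinnertonDyer.Theorems.TeichmullerTwistDescent.TwistedPeriodLatticeDichotomy

variable (p : ℕ) [hp : Fact p.Prime] {k : Type} [Field k] [CharP k p] [Algebra ℤ_[p] k] [Finite k]

/-- **K at `(W, p, D, χ)` from Modularity and a homology-level datum for `H₁(X₀(N(W)), ℤ)`, `f = f_D`** (binders of
`TwistedPeriodLatticeSaturation` verbatim, `p ≥ 11`): the tree's `stub_dichotomy_of_modularity` leaves K or case one,
and case one is excluded by `not_caseOne_of_homologyLevelDatum`.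
[cite: EdixhovenManin1991, §4] [cite: EmertonGeeSavitt2015, Lemma 4.1.1] -/
theorem saturation_at_of_homologyLevelDatum (hnf : ModularForms.exists_isNewformOf)
    (W : WeierstrassCurve ℚ) [W.IsElliptic] [W.IsGloballyMinimal] [NeZero (W.conductorNorm ℤ)]
    (D : ModularForms.ModularParametrizationData W (W.conductorNorm ℤ)) (hsq : p ^ 2 ∣ W.conductorNorm ℤ)
    (hp11 : 11 ≤ p) (hadd : Rank1Residual.Addv W p) (hirr : Rank1Residual.Irr W p)
    (hGo : Summit.BirchSwinnertonDyer.Rank1Residual.Additive.TypeGOrd W p)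
    (hV4 : padicValInt p W.minimalDiscriminantInt ≤ 4)
    (hopt : ∀ z ∈ D.L.lattice, ∃ w ∈ ModularForms.periodLattice D.f, z = D.c * w)
    (χ : DirichletCharacter ℂ p) (hχ : χ.IsQuadratic) (hprim : χ.IsPrimitive)
    {b : ℕ} (hb : 0 < b) (hb2 : 2 * b < p - 1)
    (hsurj : Surjective (algebraMap ℤ_[p] k))
    (halg : ∀ x : ℤ_[p], algebraMap ℤ_[p] k x = ZMod.castHom (dvd_refl p) k (PadicInt.toZMod x))
    (Λ' : Subrepresentation
      (coordRep (Kato2004.teichmullerChar p ^ (p - 1 - b)) (Kato2004.teichmullerChar p ^ b))) {m : ℕ}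
    (hm : ∀ v : Option (ZMod p) → ℤ_[p], (p : ℤ_[p]) ^ m • v ∈ Λ')
    (hsoc : ReductionSocleLe p k (Kato2004.teichmullerChar p ^ (p - 1 - b)) (Kato2004.teichmullerChar p ^ b) (2 * b) Λ')
    (βH βHχ : ModularForms.periodHomology (W.conductorNorm ℤ) →+ (Option (ZMod p) → ℤ_[p]))
    (hker : ∀ φ : ModularForms.periodHomology (W.conductorNorm ℤ),
      (φ : Module.Dual ℂ (CuspForm (Gamma0 (W.conductorNorm ℤ)) 2)) D.f = 0 → βH φ = 0)
    (hβW : ∀ φ : ModularForms.periodHomology (W.conductorNorm ℤ), βH φ ∈ Λ'.toSubmodule ⊓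
      coordTorusEigenspace (Kato2004.teichmullerChar p ^ (p - 1 - b)) (Kato2004.teichmullerChar p ^ b)
        (fun _ _ => (1 : ℤ_[p])))
    (hβV : Λ'.toSubmodule ⊓
        coordTorusEigenspace (Kato2004.teichmullerChar p ^ (p - 1 - b)) (Kato2004.teichmullerChar p ^ b)
          (fun a c : (ZMod p)ˣ => MulChar.ofUnitHom (Kato2004.teichmullerChar p ^ ((p - 1) / 2)) (a : ZMod p) *
            MulChar.ofUnitHom (Kato2004.teichmullerChar p ^ ((p - 1) / 2)) (c : ZMod p)) ≤
      Submodule.span ℤ_[p] (Set.range βHχ))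
    (hβ : ∀ φ ψ : ModularForms.periodHomology (W.conductorNorm ℤ),
      (∀ h : CuspForm (Gamma0 (W.conductorNorm ℤ)) 2, (ψ : Module.Dual ℂ (CuspForm (Gamma0 (W.conductorNorm ℤ)) 2)) h =
        gaussSum χ (ZMod.stdAddChar (N := p)) *
          (φ : Module.Dual ℂ (CuspForm (Gamma0 (W.conductorNorm ℤ)) 2))
            (ModularForms.charTwist (W.conductorNorm ℤ) dvd_rfl hsq hχ h)) →
      βH ψ = coordTwistOp (Kato2004.teichmullerChar p ^ (p - 1 - b)) (Kato2004.teichmullerChar p ^ b)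
        (MulChar.ofUnitHom (Kato2004.teichmullerChar p ^ ((p - 1) / 2))) (βHχ φ)) :
    ∀ z ∈ ModularForms.periodLattice D.f, ∃ w ∈ ModularForms.periodLattice
        (ModularForms.charTwist (W.conductorNorm ℤ) (dvd_refl _) hsq hχ D.f),
      z = gaussSum χ (ZMod.stdAddChar (N := p)) * w := by
  rcases stub_dichotomy_of_modularity hnf W p D hsq hp11 hadd hirr hGo hV4 hopt χ hχ hprim with h | hcase
  · exact h
  · exact (not_caseOne_of_homologyLevelDatum p (by omega) hb hb2 hsurj halg Λ' hm hsoc hsq D.f hχ hprim βH βHχ hker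
      hβW hβV hβ hcase).elim

end K

end Summit.BirchSwinnertonDyer.BirchSwinnertonDyer.Theorems.TeichmullerTwistDescent.TypeLatticeHomologyLevel
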